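import Summits.Parity.GeneralizedHardyLittlewood.Theses.LeeYangFibres
import Summits.Parity.GeneralizedHardyLittlewood.Theorems.LeeYangFibresRelativeDimOneTypeSplit
import HarnessLib

/-!
# Line `gallagher-backwards-split` — skeleton v3 (seat c2) for the crux `RelativeDimOne` (stmt-Parity-14113):
# the crux modulo its two ATOMS, everything else LANDED

Route `LeeYangFibres` (Parity / GeneralizedHardyLittlewood); crux decl
`Summit.Parity.GeneralizedHardyLittlewood.Theses.LeeYangFibres.RelativeDimOne`. Lead seat c2
(`prover-line-stmt-Parity-14113-c2-0`), 2026-08-16. This is the registry form of seat c1's reshaped skeleton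
`Cruxes/RelativeDimOne/Lines/gallagher_backwards_split_c1.lean` (v2): the five provable stubs of the type-conditioned
split (`stub_typeClassMoments` p117562, `stub_typeRigidity` p120397, `stub_singularWeights` p119458, `stub_typeData`
p119410, `stub_endgame` p116137) and the composition (`relativeDimOne_of_atoms`, with the equivalence
`relativeDimOne_iff_coreDecay_and_lowSecondMoment` and `relativeDimOne_iff_general`, p120512) are LANDED in
`Theorems/LeeYangFibresRelativeDimOneTypeSplit.lean` and imported here, so that the registered stub list is exactly the two
open atoms below and nothing superseded (the v1 registry still carried `stub_rigidity : IncidenceRigidity (1/4) (3/10)`,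
REFUTED in `Cruxes/RelativeDimOne/StubRigidityFalse-c1.md`, and its dependants `stub_inversion`, `stub_classMoments`,
`stub_core`).

## The line = two stubs, both ATOMS (open problems; each provably NECESSARY for the crux)

* `stub_coreDecay : IncidenceBandlimitedCoreDecay (1/4)` — ATOM P′ (parity content): at each scale some squarefree-
  supported, type-invariant, Hardy–Littlewood-decaying incidence spectrum of level `N^{1/4}` reproduces every `S(Ψ,K)` to
  relative accuracy `ε(β_∞|M| + N)`. Necessary: `coreDecay_of_relativeDimOne` (any level `θ > 0`). For `t ≥ 2` any
  exhibited spectrum pins prime-pair asymptotics (or `o(N)` upper bounds) uniformly in the shifts — open.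
* `stub_lowSecondMoment : LowClassSecondMoment (1/3)` — ATOM L (`L`-function content): `Σ_a ψ(N;q,a)² ≤
  (1+ε)(N²/φ(q) + N log N)` for `q ≤ N^{1/3}`. Necessary at every level `θ₁ ≤ 1`
  (`lowClassSecondMoment_of_relativeDimOne`, Gallagher backwards p92797); forces character PNT uniformly to conductor
  `N^{1/3}` (cf. `characterNecessity` p92764) — Siegel-hard, open; implied by GRH: seat c2's calibration
  `lowClassSecondMoment_of_grh` / `relativeDimOne_iff_coreDecay_of_grh` (`Theorems/LeeYangFibresRelativeDimOneGRHCalibration.lean`,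
  tools `…GRHCalibrationChar.lean` p122065) — UNDER GRH THE CRUX IS EQUIVALENT TO ATOM P′ ALONE.

Composition: `relativeDimOne_modulo_stubs` (the crux from the two stubs BY NAME, closed modulo the two `sorry`s); the
hypothesis form is the landed `relativeDimOne_of_atoms`. Disproof.lean (cdisprove cycle 1 final, 09:46Z): NO KILL,
`-- Targets`: none; compatibility examples at the end.
-/

noncomputable section

open scoped BigOperators Classical Topology
open Finset Filter MeasureTheory Literature.NumberTheory.Sieve
open Summit.Parity.GeneralizedHardyLittlewood.Theses.LeeYangFibres (RelativeDimOne)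
open Summit.Parity.GeneralizedHardyLittlewood.Cruxes.RelativeDimOne.GallagherBackwards
open Summit.Parity.GeneralizedHardyLittlewood.Cruxes.RelativeDimOne.GallagherBackwardsSplit

namespace Summit.Parity.GeneralizedHardyLittlewood.Cruxes.RelativeDimOne.TypeSplit

/-! ### The two atoms (the only stubs) -/

/-- ATOM P′ (OPEN): the incidence-bandlimited core with Hardy–Littlewood decay at level `N^{1/4}`. -/
theorem stub_coreDecay : IncidenceBandlimitedCoreDecay (1 / 4) := by
  sorry

/-- ATOM L (OPEN): the sharp class second moment below level `N^{1/3}`. -/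
theorem stub_lowSecondMoment : LowClassSecondMoment (1 / 3) := by
  sorry

/-! ### The composition -/

/-- **The crux from the two stubs, BY NAME** (concludes `LeeYangFibres.RelativeDimOne`; closed modulo the two `sorry`s):
the landed composition `relativeDimOne_of_atoms` (five landed provable stubs inside) applied to the two atoms. -/
theorem relativeDimOne_modulo_stubs : RelativeDimOne :=
  relativeDimOne_of_atoms stub_coreDecay stub_lowSecondMoment

/-- Hypothesis form of the same composition (sorry-free, landed as `relativeDimOne_of_atoms`): the two atom
STATEMENTS imply the crux. (An `example`, so that `relativeDimOne_modulo_stubs` is the file's only crux-concluding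
theorem for the skeleton audit.) -/
example : IncidenceBandlimitedCoreDecay (1 / 4) → LowClassSecondMoment (1 / 3) → RelativeDimOne :=
  fun hP hL => relativeDimOne_of_atoms hP hL

/-! ### Landed certificates (pointers; all sorry-free in the imported file) -/

example : RelativeDimOne ↔ (IncidenceBandlimitedCoreDecay (1 / 4) ∧ LowClassSecondMoment (1 / 3)) :=
  relativeDimOne_iff_coreDecay_and_lowSecondMoment

example {θ θ₁ : ℝ} (hθ0 : 0 < θ) (hθ1 : θ < 1) (hθ₁ : 0 < θ₁) (hθ₁1 : θ₁ ≤ 1) :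
    RelativeDimOne ↔ (IncidenceBandlimitedCoreDecay θ ∧ LowClassSecondMoment θ₁) :=
  relativeDimOne_iff_general hθ0 hθ1 hθ₁ hθ₁1

/-! ### §Disproof — the landed Negative lemmas of this crux (load-bearing hypotheses all kept by the atoms) -/

section DisproofCompatibility
open Summit.Parity.GeneralizedHardyLittlewood.Theorems.RelativeDimOne.Negative

example : ¬ RelativeDimOneWithoutSize := relativeDimOne_false_without_size
example : ¬ RelativeDimOneWithoutBox := relativeDimOne_false_without_box
example : ¬ RelativeDimOneWithoutConvex := relativeDimOne_false_without_convex
example : ¬ RelativeDimOneWithoutNondegenerate := relativeDimOne_false_without_nondegenerate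
example : ¬ RelativeDimOneWithoutNonproportional := relativeDimOne_false_without_nonproportional
example : ¬ PurelyRelativeDimOne := not_purelyRelativeDimOne
example : ¬ RelativeDimOneLogSlack := not_relativeDimOneLogSlack
example : ¬ RelativeDimOneUniformInSize := not_relativeDimOneUniformInSize

end DisproofCompatibility

end Summit.Parity.GeneralizedHardyLittlewood.Cruxes.RelativeDimOne.TypeSplit

end
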